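import Literature.NumberTheory.EllipticCurves.TorsionFilAtCyclicOrdinaryProofs
import Literature.NumberTheory.EllipticCurves.GaloisActionProofs
import Literature.NumberTheory.EllipticCurves.TateModuleProofs
import Literature.NumberTheory.EllipticCurves.IwasawaTwistModPkDual
import Mathlib.Data.ZMod.QuotientGroup
import HarnessLib

/-!
# `Fil_v E[p^k] = E[p^k] ∩ E₁(K̄_v)` has order exactly `p^k` at a place `v ∋ p` of good ordinary reduction
# (theorems only; no definition, no named fact, no instance, no `sorry`)

Topic `NumberTheory/EllipticCurves` (sequel to `TorsionFilAtCyclicOrdinaryProofs` — `Fil_v E[p^k]` is cyclic and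
`E₁(K̄_v) ∩ E(K̄_v)[p^k]` is cyclic of order `p^k` on a generator — and `GaloisActionProofs` (`#E(L)[n] = n²` over an
algebraically closed `L`); cell `pub/bsd-print-x9`, brick (B3) of `HOME/p1/H4-EXACT-AT-P-PLAN`).

Greenberg [LNM 1716, §1 p. 62, §2 pp. 82–83]: at a prime of good ORDINARY reduction `ℱ[p^k] = E[p^k] ∩ E₁ ≅ ℤ/p^k`.  Howard
[Compositio Math. 140 (2004), §3.1 and Lemma 3.1.1, arXiv:1202.6340 p. 15 L56–62]: `Fil_v T = ker (T_p E → T_p Ẽ)` has rank one and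
is its own EXACT orthogonal complement under the Weil pairing — at the finite level this exactness is the count
`#Fil_v E[p^k] · #Fil_v E[p^k] = #E[p^k]`, i.e. `#Fil_v E[p^k] = p^k`.  The tree's `WeierstrassCurve.torsionFilAt W v (p^k)` lives in
the GLOBAL torsion `E(K̄)[p^k]` (embedded into `E(K̄_v)` by `pointsMapOfEmb`); this file transports the local count:

* `WeierstrassCurve.exists_geomTorsion_pointsMapOfEmb_eq` — **every `p^k`-torsion point of `E(K̄_v)` comes from `E(K̄)[p^k]`**:
  the injection `E(K̄)[p^k] ↪ E(K̄_v)[p^k]` between sets of the same size `p^{2k}` (`card_torsionPoints_eq_sq_holds` over both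
  algebraic closures) is onto;
* `WeierstrassCurve.natCard_torsionFilAt_le` — `#Fil_v E[p^k] ≤ p^k` (it embeds into the cyclic `E₁(K̄_v) ∩ E(K̄_v)[p^k] = ℤ P₁`,
  `addOrderOf P₁ = p^k`);
* **`WeierstrassCurve.natCard_torsionFilAt_eq`** — `#Fil_v E[p^k] = p^k` (the generator `P₁` comes from a point of `Fil_v E[p^k]`
  of order `p^k`);
* **`WeierstrassCurve.natCard_torsionFilAt_mul_self`** — `#Fil_v E[p^k] · #Fil_v E[p^k] = #E[p^k]`, the `hcard` input of
  `Submodule.mem_of_forall_mem_eq_zero_of_sq` / `conjPairing_restricted_right_exact` (Howard's Lemma 3.1.1 at the `E`-level).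

Hypotheses as in `TorsionFilAtCyclicOrdinaryProofs`: good reduction at `v ∋ p` and an ORDINARY point (some `p`-torsion point
of `E(K̄_v)` outside `E₁(K̄_v)`; from `p ∤ a_v` by `TorsionFilAtCyclicOfFrobeniusTraceProofs`).  No summit statement is proved; BSD
is not proved by any of this.  Seat `bsd-line-x10b-p1-w7` g2.

References: [GreenbergLNM1716] §1 p. 62, §2 pp. 82–83; [Howard2004HeegnerKolyvagin] §3.1, Lemma 3.1.1 (arXiv:1202.6340 p. 15,
L56–62); [SilvermanAEC2009] III Cor. 6.4 (`#E[n] = n²`), VII.2 Props. 2.1–2.2 (`E₁`).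
-/

noncomputable section

open NumberField IsDedekindDomain Field Function

namespace WeierstrassCurve

open Literature.NumberTheory.EllipticCurves Literature.NumberTheory.GaloisRepresentations AddSubgroup

universe u

variable {K : Type u} [Field K] [NumberField K] (W : WeierstrassCurve K) [W.IsElliptic]
  (v : HeightOneSpectrum (𝓞 K)) {p : ℕ} [hp : Fact p.Prime]

/-- **Every `p^k`-torsion point of `E(K̄_v)` comes from a (unique) point of `E(K̄)[p^k]`** under the chosen embedding
`K̄ → K̄_v`: `pointsMapOfEmb` is injective and both torsion groups have `p^{2k}` elements.
[cite: SilvermanAEC2009, III Cor. 6.4 (#E[n] = n² over any algebraically closed field of characteristic 0)] -/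
theorem exists_geomTorsion_pointsMapOfEmb_eq (k : ℕ) (P : localPoints W (v.adicCompletion K))
    (hP : ((p ^ k : ℕ) : ℤ) • P = 0) :
    ∃ Q : geomPoints W, ((p ^ k : ℕ) : ℤ) • Q = 0 ∧
      pointsMapOfEmb W (closureEmb (K := K) (v.adicCompletion K)) Q = P := by
  set ι := pointsMapOfEmb W (closureEmb (K := K) (v.adicCompletion K)) with hι
  have hn0 : (p ^ k : ℕ) ≠ 0 := pow_ne_zero k hp.out.ne_zero
  have hpK : (p : K) ≠ 0 := Nat.cast_ne_zero.mpr hp.out.ne_zero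
  haveI : CharZero (v.adicCompletion K) := charZero_of_injective_algebraMap (algebraMap K _).injective
  have hnL : ((p ^ k : ℕ) : AlgebraicClosure (v.adicCompletion K)) ≠ 0 := Nat.cast_ne_zero.mpr hn0
  have hcK : Nat.card (geomTorsion W (p ^ k : ℕ)) = p ^ (2 * k) :=
    W.card_geomTorsion_pow_eq p (card_torsionPoints_eq_sq_holds W (AlgebraicClosure K)) hpK k
  have hcL : Nat.card (torsionPoints W (AlgebraicClosure (v.adicCompletion K)) (p ^ k : ℕ)) = (p ^ k) ^ 2 :=
    card_torsionPoints_eq_sq_holds W (AlgebraicClosure (v.adicCompletion K)) hnL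
  haveI : Finite (geomTorsion W (p ^ k : ℕ)) :=
    Nat.finite_of_card_ne_zero (by rw [hcK]; exact pow_ne_zero _ hp.out.ne_zero)
  haveI : Finite (torsionPoints W (AlgebraicClosure (v.adicCompletion K)) (p ^ k : ℕ)) :=
    Nat.finite_of_card_ne_zero (by rw [hcL]; exact pow_ne_zero 2 hn0)
  -- the restriction of `ι` to the `p^k`-torsion
  let g : geomTorsion W (p ^ k : ℕ) → torsionPoints W (AlgebraicClosure (v.adicCompletion K)) (p ^ k : ℕ) := fun Q ↦
    ⟨ι Q.1, (mem_torsionPoints_iff W _ _).mpr (by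
      have h : ((p ^ k : ℕ) : ℤ) • ι Q.1 = 0 := by
        rw [← map_zsmul, (Submodule.mem_torsionBy_iff _ _).mp Q.2, map_zero]
      exact h)⟩
  have hg : Injective g := fun Q Q' h ↦
    Subtype.ext (pointsMapOfEmb_injective W (closureEmb (K := K) (v.adicCompletion K)) (congrArg Subtype.val h))
  have hbij : Bijective g := hg.bijective_of_nat_card_le (by rw [hcK, hcL, ← pow_mul, mul_comm])
  obtain ⟨Q, hQ⟩ := hbij.2 ⟨P, (mem_torsionPoints_iff W _ _).mpr hP⟩
  exact ⟨Q.1, (Submodule.mem_torsionBy_iff _ _).mp Q.2, congrArg Subtype.val hQ⟩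

omit [W.IsElliptic] in
/-- **`#Fil_v E[p^k] ≤ p^k`**: `Fil_v E[p^k]` embeds (by `pointsMapOfEmb`) into `E₁(K̄_v) ∩ E(K̄_v)[p^k]`, which is the cyclic
group on a generator `P₁` of order `p^k`. [cite: GreenbergLNM1716, §1 p. 62 (ℱ[p^k] ≅ ℤ/p^k)]
[cite: Howard2004HeegnerKolyvagin, §3.1 (arXiv p. 15, L56–62: Fil_v T has rank one)] -/
theorem natCard_torsionFilAt_le (hgood : W.HasGoodReductionAt v) (hpv : (p : 𝓞 K) ∈ v.asIdeal)
    (hord : ∃ P : localPoints W (v.adicCompletion K), (p : ℤ) • P = 0 ∧ P ∉ W.localKernelOfReduction v) (k : ℕ) :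
    Nat.card (W.torsionFilAt v ((p : ℤ) ^ k)) ≤ p ^ k := by
  obtain ⟨P₁, -, hord₁, hgen⟩ := W.exists_generator_localKernelOfReduction_torsion v hgood hpv hord k
  set ι := pointsMapOfEmb W (closureEmb (K := K) (v.adicCompletion K)) with hι
  have hmul : ∀ P : W.torsionFilAt v ((p : ℤ) ^ k),
      ι ((P : geomTorsion W ((p : ℤ) ^ k)) : geomPoints W) ∈ zmultiples P₁ := by
    intro P
    have hPk : ((p ^ k : ℕ) : ℤ) • ι ((P : geomTorsion W ((p : ℤ) ^ k)) : geomPoints W) = 0 := by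
      have h2 : ((p : ℤ) ^ k) • ((P : geomTorsion W ((p : ℤ) ^ k)) : geomPoints W) = 0 :=
        (Submodule.mem_torsionBy_iff _ _).mp (P : geomTorsion W ((p : ℤ) ^ k)).2
      rw [← map_zsmul, Nat.cast_pow, h2, map_zero]
    obtain ⟨c, hc⟩ := hgen _ ((W.mem_torsionFilAt_iff v _ _).mp P.2) hPk
    rw [hc]
    exact AddSubgroup.nsmul_mem _ (mem_zmultiples P₁) c
  let f : W.torsionFilAt v ((p : ℤ) ^ k) → zmultiples P₁ := fun P ↦ ⟨_, hmul P⟩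
  have hf : Injective f := fun P P' h ↦ by
    have h' := congrArg Subtype.val h
    exact Subtype.ext (Subtype.ext (pointsMapOfEmb_injective W _ h'))
  haveI : Finite (zmultiples P₁) := Nat.finite_of_card_ne_zero (by
    rw [Nat.card_zmultiples, hord₁]; exact pow_ne_zero k hp.out.ne_zero)
  calc Nat.card (W.torsionFilAt v ((p : ℤ) ^ k)) ≤ Nat.card (zmultiples P₁) := Nat.card_le_card_of_injective f hf
    _ = p ^ k := by rw [Nat.card_zmultiples, hord₁]

/-- **`#Fil_v E[p^k] = p^k` at a place `v ∋ p` of good ordinary reduction**: the generator `P₁` of `E₁(K̄_v) ∩ E(K̄_v)[p^k]`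
(order `p^k`) comes from a point of `Fil_v E[p^k]` of order `p^k` (`exists_geomTorsion_pointsMapOfEmb_eq`, injective homomorphisms
preserve orders), so `p^k ∣ #Fil_v E[p^k] ≤ p^k`. [cite: GreenbergLNM1716, §1 p. 62 and §2 pp. 82–83 (ℱ[p^k] ≅ ℤ/p^k at an ordinary prime)]
[cite: Howard2004HeegnerKolyvagin, §3.1 and Lemma 3.1.1 (arXiv:1202.6340 p. 15, L56–62)] -/
theorem natCard_torsionFilAt_eq (hgood : W.HasGoodReductionAt v) (hpv : (p : 𝓞 K) ∈ v.asIdeal)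
    (hord : ∃ P : localPoints W (v.adicCompletion K), (p : ℤ) • P = 0 ∧ P ∉ W.localKernelOfReduction v) (k : ℕ) :
    Nat.card (W.torsionFilAt v ((p : ℤ) ^ k)) = p ^ k := by
  refine le_antisymm (W.natCard_torsionFilAt_le v hgood hpv hord k) ?_
  obtain ⟨P₁, hP₁, hord₁, -⟩ := W.exists_generator_localKernelOfReduction_torsion v hgood hpv hord k
  set ι := pointsMapOfEmb W (closureEmb (K := K) (v.adicCompletion K)) with hι
  -- `P₁` comes from a global `p^k`-torsion point `Q`
  have hP₁k : ((p ^ k : ℕ) : ℤ) • P₁ = 0 := by rw [natCast_zsmul, ← hord₁, addOrderOf_nsmul_eq_zero]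
  obtain ⟨Q, hQk, hQ⟩ := W.exists_geomTorsion_pointsMapOfEmb_eq v k P₁ hP₁k
  have hQk' : ((p : ℤ) ^ k) • Q = 0 := by rw [← Nat.cast_pow]; exact hQk
  have hQmem : Q ∈ geomTorsion W ((p : ℤ) ^ k) := (Submodule.mem_torsionBy_iff _ _).mpr hQk'
  let Qt : geomTorsion W ((p : ℤ) ^ k) := ⟨Q, hQmem⟩
  have hQt : Qt ∈ W.torsionFilAt v ((p : ℤ) ^ k) := by
    rw [W.mem_torsionFilAt_iff v]
    change ι Q ∈ W.localKernelOfReduction v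
    rw [hQ]; exact hP₁
  -- its order in `Fil_v E[p^k]` is `p^k`
  let F : W.torsionFilAt v ((p : ℤ) ^ k) →+ localPoints W (v.adicCompletion K) :=
    ι.comp ((geomTorsion W ((p : ℤ) ^ k)).subtype.comp (W.torsionFilAt v ((p : ℤ) ^ k)).subtype.toAddMonoidHom)
  have hF : Injective F := fun x y h ↦
    Subtype.ext (Subtype.ext (pointsMapOfEmb_injective W _ h))
  have hFx : F ⟨Qt, hQt⟩ = P₁ := hQ
  have hx : addOrderOf (⟨Qt, hQt⟩ : W.torsionFilAt v ((p : ℤ) ^ k)) = p ^ k := by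
    rw [← addOrderOf_injective F hF, hFx, hord₁]
  haveI : Finite (geomTorsion W ((p : ℤ) ^ k)) :=
    finite_torsionPoints_holds W (AlgebraicClosure K) (pow_ne_zero k (Nat.cast_ne_zero.mpr hp.out.ne_zero))
  exact Nat.le_of_dvd Nat.card_pos (hx ▸ addOrderOf_dvd_natCard _)

/-- **`#Fil_v E[p^k] · #Fil_v E[p^k] = #E[p^k]`** (`p^k · p^k = p^{2k}`): the cardinality input of the exact-orthogonality
statement «`Fil_v` is its own exact orthogonal complement under the Weil pairing» (Howard's Lemma 3.1.1 at the `E`-level,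
`Submodule.mem_of_forall_mem_eq_zero_of_sq`). [cite: Howard2004HeegnerKolyvagin, Lemma 3.1.1 (arXiv:1202.6340 p. 15, L60–62)]
[cite: SilvermanAEC2009, III Cor. 6.4] -/
theorem natCard_torsionFilAt_mul_self (hgood : W.HasGoodReductionAt v) (hpv : (p : 𝓞 K) ∈ v.asIdeal)
    (hord : ∃ P : localPoints W (v.adicCompletion K), (p : ℤ) • P = 0 ∧ P ∉ W.localKernelOfReduction v) (k : ℕ) :
    Nat.card (W.torsionFilAt v ((p : ℤ) ^ k)) * Nat.card (W.torsionFilAt v ((p : ℤ) ^ k)) =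
      Nat.card (geomTorsion W ((p : ℤ) ^ k)) := by
  have hpK : (p : K) ≠ 0 := Nat.cast_ne_zero.mpr hp.out.ne_zero
  have hE : Nat.card (geomTorsion W ((p : ℤ) ^ k)) = p ^ (2 * k) := by
    rw [Nat.card_congr (W.geomTorsionPowCongr p k).toEquiv]
    exact W.card_geomTorsion_pow_eq p (card_torsionPoints_eq_sq_holds W (AlgebraicClosure K)) hpK k
  rw [W.natCard_torsionFilAt_eq v hgood hpv hord k, hE, two_mul, pow_add]

end WeierstrassCurve

end
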